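import Literature.NumberTheory.LFunctions.SinnottPowerFunctions
import Literature.NumberTheory.LFunctions.SinnottUnitsModPrimePower
import Mathlib.NumberTheory.LegendreSymbol.AddCharacter
import Mathlib.Data.ZMod.Units
import Mathlib.Algebra.CharP.Lemmas
import Mathlib.Algebra.CharP.Frobenius
import HarnessLib

/-!
# Sinnott's theorem on Γ-transforms of rational function measures (Astérisque 147–148, §3)

Topic `Literature/NumberTheory/LFunctions`; namespace `Literature.NumberTheory.LFunctions.Sinnott1987`.
THEOREMS ONLY (auxiliary `def`s with bodies; no named facts).

Finite form of §1 and §3 of W. Sinnott, *On a theorem of L. Washington*, Astérisque 147–148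
(1987), 209–224.  Two distinct primes: `p = char F` and the tower prime `M`; `q` a power of `p`
with `M ∣ q - 1` (`4 ∣ q - 1` if `M = 2`), `M^{n₀} ∥ q - 1`.  A function `φ` on the `M`-power
roots of unity in `F` (Sinnott's Fourier transform `α̂` of a measure `α` on `ℤ_M`, (1.8)–(1.9))
has at level `M^m`, with respect to a primitive `M^m`-th root of unity `ζ`, the measure
`α(x) = M^{-m} ∑_{c mod M^m} ζ^{-cx} φ(ζ^c)` (`levelMeasure`, Fourier inversion
`sum_pw_mul_levelMeasure`), and for a character `ψ` of `(ℤ/M^m)ˣ` the **Γ-transform**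
`Γ_α(ψ) = ∑_{u ∈ (ℤ/M^m)ˣ} ψ(u) α(u)` (`gammaTransform`, (1.12)), which is a Gauss sum times
`∑_{c ∈ (ℤ/M^m)ˣ} ψ⁻¹(c) φ(ζ^c)` (`gammaTransform_eq_gaussSum_mul`).

This file proves the pieces of Sinnott's Lemma 3.6 / Theorem 3.2 that are finite Fourier
analysis on `ℤ/M^m` … (continued in the sections below).

## References

* W. Sinnott, *On a theorem of L. Washington*, Astérisque 147–148 (1987), 209–224, §1, §3.
  [Sinnott1987]
* L. C. Washington, *The non-`p`-part of the class number in a cyclotomic `ℤ_p`-extension*,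
  Invent. Math. 49 (1978), 87–97. [Washington1978]
-/

noncomputable section

open Finset AddChar

namespace Literature.NumberTheory.LFunctions.Sinnott1987

variable {F : Type*} [Field F]

/-! ### Finite Fourier analysis on `ℤ/n` with a primitive `n`-th root of unity -/

section Fourier

variable {n : ℕ} [NeZero n] {ζ : F}

/-- `ζ^x` for `x ∈ ℤ/n` (`= zmodChar n _ x`). [folklore] -/
def pw (ζ : F) (x : ZMod n) : F := ζ ^ x.val

omit [NeZero n] in
/-- Unfolding `pw`. [folklore] -/
theorem pw_def (ζ : F) (x : ZMod n) : pw ζ x = ζ ^ x.val := rfl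

/-- `pw` is the additive character `zmodChar`. [folklore] -/
theorem pw_eq_zmodChar (hζ : ζ ^ n = 1) (x : ZMod n) : pw ζ x = zmodChar n hζ x := rfl

/-- `ζ^{x+y} = ζ^x ζ^y`. [folklore] -/
theorem pw_add (hζ : ζ ^ n = 1) (x y : ZMod n) : pw ζ (x + y) = pw ζ x * pw ζ y := by
  simp only [pw_eq_zmodChar hζ, map_add_eq_mul]

omit [NeZero n] in
/-- `ζ^0 = 1`. [folklore] -/
@[simp] theorem pw_zero (ζ : F) : pw ζ (0 : ZMod n) = 1 := by simp [pw]

/-- `pw ζ k = ζ^k` for a natural number `k`. [folklore] -/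
theorem pw_natCast (hζ : ζ ^ n = 1) (k : ℕ) : pw ζ (k : ZMod n) = ζ ^ k := by
  rw [pw_eq_zmodChar hζ, zmodChar_apply']

/-- `ζ^{x k} = (ζ^x)^k`. [folklore] -/
theorem pw_mul_natCast (hζ : ζ ^ n = 1) (x : ZMod n) (k : ℕ) :
    pw ζ (x * (k : ZMod n)) = pw ζ x ^ k := by
  rw [pw_eq_zmodChar hζ, pw_eq_zmodChar hζ, ← nsmul_eq_mul', map_nsmul_eq_pow]

/-- `ζ^{x y} = (ζ^x)^{y.val}`. [folklore] -/
theorem pw_mul (hζ : ζ ^ n = 1) (x y : ZMod n) : pw ζ (x * y) = pw ζ x ^ y.val := by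
  conv_lhs => rw [← ZMod.natCast_zmod_val y]
  exact pw_mul_natCast hζ x y.val

/-- `ζ^x ≠ 0`. [folklore] -/
theorem pw_ne_zero (hζ : IsPrimitiveRoot ζ n) (x : ZMod n) : pw ζ x ≠ 0 :=
  pow_ne_zero _ (hζ.ne_zero (NeZero.ne n))

/-- `ζ^{-x} = (ζ^x)⁻¹`. [folklore] -/
theorem pw_neg (hζ : IsPrimitiveRoot ζ n) (x : ZMod n) : pw ζ (-x) = (pw ζ x)⁻¹ := by
  have h := pw_add hζ.pow_eq_one x (-x)
  rw [add_neg_cancel, pw_zero] at h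
  field_simp [pw_ne_zero hζ x]
  rw [mul_comm]; exact h.symm

omit [NeZero n] in
/-- `pw ζ x` only depends on `ζ^{x.val}`; changing the root: `pw (ζ^k) x = pw ζ (k x)`.
[folklore] -/
theorem pw_pow (hζ : ζ ^ n = 1) (k : ℕ) (x : ZMod n) : pw (ζ ^ k) x = pw ζ ((k : ZMod n) * x) := by
  rw [pw_def, pw_def, ← pow_mul]
  refine pow_eq_pow_of_modEq hζ ?_
  rw [ZMod.val_mul, ZMod.val_natCast]
  exact ((Nat.mod_modEq _ n).trans ((Nat.mod_modEq k n).mul_right _)).symm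

/-- **Orthogonality**: `∑_x ζ^{x b} = n [b = 0]` for a primitive `n`-th root of unity `ζ`.
[folklore] -/
theorem sum_pw_mul (hζ : IsPrimitiveRoot ζ n) (b : ZMod n) :
    ∑ x : ZMod n, pw ζ (x * b) = if b = 0 then (n : F) else 0 := by
  classical
  have h := AddChar.sum_mulShift b (zmodChar_primitive_of_primitive_root n hζ)
  simp only [ZMod.card] at h
  simpa [pw_eq_zmodChar hζ.pow_eq_one] using h

end Fourier

/-! ### The level-`n` measure attached to a function on `μ_n`; Fourier inversion -/

section LevelMeasure

variable {n : ℕ} [NeZero n] {ζ : F}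

/-- The **level-`n` measure** of a function `φ` on `μ_n` with respect to a primitive `n`-th root of
unity `ζ`: `α(x) := n⁻¹ ∑_{c mod n} ζ^{-cx} φ(ζ^c)` (so that `φ(ζ^e) = ∑_x ζ^{ex} α(x)` is the Fourier
transform (1.9) of `α`). [cite: Sinnott1987, (1.3), (1.9)] -/
def levelMeasure (ζ : F) (φ : F → F) (x : ZMod n) : F :=
  (n : F)⁻¹ * ∑ c : ZMod n, pw ζ (-(c * x)) * φ (pw ζ c)

/-- Unfolding `levelMeasure`. [folklore] -/
theorem levelMeasure_def (ζ : F) (φ : F → F) (x : ZMod n) :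
    levelMeasure ζ φ x = (n : F)⁻¹ * ∑ c : ZMod n, pw ζ (-(c * x)) * φ (pw ζ c) := rfl

/-- **Fourier inversion**: `∑_x ζ^{ex} α(x) = φ(ζ^e)`. [cite: Sinnott1987, (1.9) and "Fourier
inversion", p. 211] -/
theorem sum_pw_mul_levelMeasure (hζ : IsPrimitiveRoot ζ n) (hn : (n : F) ≠ 0) (φ : F → F)
    (e : ZMod n) : ∑ x : ZMod n, pw ζ (e * x) * levelMeasure ζ φ x = φ (pw ζ e) := by
  classical
  have h1 : ∀ c x : ZMod n, pw ζ (e * x) * pw ζ (-(c * x)) = pw ζ (x * (e - c)) := by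
    intro c x; rw [← pw_add hζ.pow_eq_one]; congr 1; ring
  have h2 : ∀ c : ZMod n, ∑ x : ZMod n, pw ζ (e * x) * pw ζ (-(c * x)) =
      if e = c then (n : F) else 0 := by
    intro c
    simp_rw [h1, sum_pw_mul hζ, sub_eq_zero]
  calc ∑ x : ZMod n, pw ζ (e * x) * levelMeasure ζ φ x
      = (n : F)⁻¹ * ∑ c : ZMod n, φ (pw ζ c) * ∑ x : ZMod n, pw ζ (e * x) * pw ζ (-(c * x)) := by
        simp only [levelMeasure_def, mul_sum]
        rw [sum_comm]
        exact sum_congr rfl fun c _ ↦ sum_congr rfl fun x _ ↦ by ring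
    _ = φ (pw ζ e) := by
        simp_rw [h2, mul_ite, mul_zero, Finset.sum_ite_eq, mem_univ, if_true]
        rw [mul_comm (φ _) _, ← mul_assoc, inv_mul_cancel₀ hn, one_mul]

variable {p : ℕ} [Fact p.Prime] [CharP F p]

omit [NeZero n] in
/-- Natural numbers are fixed by the Frobenius `x ↦ x^{p^d}`. [folklore] -/
theorem natCast_pow_prime_pow (d k : ℕ) : ((k : F)) ^ p ^ d = k := by
  have := map_natCast (iterateFrobenius F p d) k
  rwa [iterateFrobenius_def] at this

/-- **The level measure of a Frobenius-equivariant function takes values in `𝔽_q`**: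
`α(x)^q = α(x)` when `φ(y)^q = φ(y^q)` on `μ_n` and `q` is prime to `n`.
[cite: Sinnott1987, §1.16 (last paragraph) and (3.5)] -/
theorem levelMeasure_pow_eq {q d : ℕ} (hqd : q = p ^ d) (hqn : q.Coprime n) (hζn : ζ ^ n = 1)
    {φ : F → F} (hφ : ∀ x : F, x ^ n = 1 → φ x ^ q = φ (x ^ q)) (x : ZMod n) :
    levelMeasure ζ φ x ^ q = levelMeasure ζ φ x := by
  set qu : (ZMod n)ˣ := ZMod.unitOfCoprime q hqn with hqu_def
  have hqu : (qu : ZMod n) = ((q : ℕ) : ZMod n) := ZMod.coe_unitOfCoprime _ _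
  have hpw : ∀ c : ZMod n, (pw ζ c) ^ n = 1 := fun c ↦ by
    rw [pw_def, ← pow_mul, mul_comm, pow_mul, hζn, one_pow]
  have hfrob : ∀ y : F, y ^ q = iterateFrobenius F p d y := fun y ↦ by
    rw [iterateFrobenius_def, hqd]
  calc levelMeasure ζ φ x ^ q
      = (n : F)⁻¹ * ∑ c : ZMod n, pw ζ (-(c * x)) ^ q * φ (pw ζ c) ^ q := by
        rw [levelMeasure_def, hfrob, map_mul, map_inv₀, map_natCast, map_sum]
        simp_rw [map_mul, ← hfrob]
    _ = (n : F)⁻¹ * ∑ c : ZMod n, pw ζ (-((c * (qu : ZMod n)) * x)) * φ (pw ζ (c * (qu : ZMod n))) := by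
        congr 1
        refine sum_congr rfl fun c _ ↦ ?_
        rw [hφ _ (hpw c), ← pw_mul_natCast hζn, ← pw_mul_natCast hζn, hqu]
        congr 2; ring
    _ = levelMeasure ζ φ x := by
        rw [levelMeasure_def]
        congr 1
        exact Equiv.sum_comp (Units.mulRight qu) (fun c ↦ pw ζ (-(c * x)) * φ (pw ζ c))

end LevelMeasure

/-! ### The Γ-transform and its relation to Gauss sums -/

section Gamma

variable {n : ℕ} [NeZero n] {ζ : F}

/-- The **Γ-transform** `Γ_α(ψ) = ∑_{u ∈ (ℤ/n)ˣ} ψ(u) α(u)` of the level measure `α` of `φ`.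
[cite: Sinnott1987, (1.12)] -/
def gammaTransform (ζ : F) (φ : F → F) (ψ : (ZMod n)ˣ →* Fˣ) : F :=
  ∑ u : (ZMod n)ˣ, (ψ u : F) * levelMeasure ζ φ (u : ZMod n)

/-- Unfolding `gammaTransform`. [folklore] -/
theorem gammaTransform_def (ζ : F) (φ : F → F) (ψ : (ZMod n)ˣ →* Fˣ) :
    gammaTransform ζ φ ψ = ∑ u : (ZMod n)ˣ, (ψ u : F) * levelMeasure ζ φ (u : ZMod n) := rfl

/-- The Gauss-type sum `G(c) = ∑_u ψ(u) ζ^{-cu}` at a unit `c` is `ψ(c)⁻¹ G(1)`. [cite: Sinnott1987,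
(1.13)–(1.15)] -/
theorem sum_psi_pw_neg_mul_unit (ψ : (ZMod n)ˣ →* Fˣ) (c : (ZMod n)ˣ) :
    ∑ u : (ZMod n)ˣ, (ψ u : F) * pw ζ (-((c : ZMod n) * (u : ZMod n))) =
      ((ψ c)⁻¹ : Fˣ) * ∑ u : (ZMod n)ˣ, (ψ u : F) * pw ζ (-(u : ZMod n)) := by
  rw [mul_sum]
  rw [← Equiv.sum_comp (Equiv.mulRight c⁻¹) _]
  refine sum_congr rfl fun u _ ↦ ?_
  simp only [Equiv.coe_mulRight, map_mul, map_inv, Units.val_mul]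
  have : (c : ZMod n) * ((u : ZMod n) * ((c⁻¹ : (ZMod n)ˣ) : ZMod n)) = u := by
    rw [mul_left_comm, Units.mul_inv, mul_one]
  rw [this]; ring

/-- The Gauss-type sum `G(c) = ∑_u ψ(u) ζ^{-cu}` vanishes at a non-unit `c` when `ψ` is primitive,
in the sense that `ψ(g) ≠ 1` for some unit `g` with `c g = c` for all non-units `c`.
[cite: Sinnott1987, (1.15) and the remark following it] -/
theorem sum_psi_pw_neg_mul_eq_zero (ψ : (ZMod n)ˣ →* Fˣ) {g : (ZMod n)ˣ}
    (hg : ∀ c : ZMod n, ¬ IsUnit c → c * g = c) (hψg : ψ g ≠ 1) {c : ZMod n} (hc : ¬ IsUnit c) :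
    ∑ u : (ZMod n)ˣ, (ψ u : F) * pw ζ (-(c * (u : ZMod n))) = 0 := by
  set G := ∑ u : (ZMod n)ˣ, (ψ u : F) * pw ζ (-(c * (u : ZMod n))) with hG
  have h1 : G = (ψ g : F) * G := by
    conv_lhs => rw [hG, ← Equiv.sum_comp (Equiv.mulRight g) _]
    rw [hG, mul_sum]
    refine sum_congr rfl fun u _ ↦ ?_
    simp only [Equiv.coe_mulRight, map_mul, Units.val_mul]
    have : c * ((u : ZMod n) * (g : ZMod n)) = c * (u : ZMod n) := by
      rw [mul_comm (u : ZMod n), ← mul_assoc, hg c hc]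
    rw [this]; ring
  have h2 : ((ψ g : F) - 1) * G = 0 := by rw [sub_mul, one_mul, ← h1, sub_self]
  rcases mul_eq_zero.mp h2 with h | h
  · exfalso; apply hψg
    rw [sub_eq_zero] at h
    exact Units.val_eq_one.mp h
  · exact h

/-- A sum over `ℤ/n` of a function vanishing off the units is the sum over `(ℤ/n)ˣ`. [folklore] -/
theorem sum_eq_sum_units_of_eq_zero {β : Type*} [AddCommMonoid β] (f : ZMod n → β)
    (hf : ∀ c, ¬ IsUnit c → f c = 0) : ∑ c : ZMod n, f c = ∑ u : (ZMod n)ˣ, f (u : ZMod n) := by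
  classical
  rw [← Finset.sum_filter_of_ne (p := IsUnit) (fun c _ hc ↦ not_imp_comm.mp (hf c) hc)]
  symm
  refine Finset.sum_nbij (fun u : (ZMod n)ˣ ↦ (u : ZMod n)) (fun u _ ↦ ?_) ?_ (fun c hc ↦ ?_)
    (fun _ _ ↦ rfl)
  · exact mem_filter.mpr ⟨mem_univ _, Units.isUnit u⟩
  · exact fun u _ v _ h ↦ Units.ext h
  · rw [coe_filter] at hc
    obtain ⟨u, rfl⟩ := hc.2
    exact ⟨u, by simp, rfl⟩

/-- **Γ-transform versus Gauss sum**: for `ψ` primitive (as above),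
`Γ_α(ψ) = n⁻¹ · G(ψ) · ∑_{c ∈ (ℤ/n)ˣ} ψ(c)⁻¹ φ(ζ^c)` with `G(ψ) = ∑_u ψ(u) ζ^{-u}`.
[cite: Sinnott1987, (1.15)] -/
theorem gammaTransform_eq_mul_sum (φ : F → F) (ψ : (ZMod n)ˣ →* Fˣ)
    {g : (ZMod n)ˣ} (hg : ∀ c : ZMod n, ¬ IsUnit c → c * g = c) (hψg : ψ g ≠ 1) :
    gammaTransform ζ φ ψ = (n : F)⁻¹ * (∑ u : (ZMod n)ˣ, (ψ u : F) * pw ζ (-(u : ZMod n))) *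
      ∑ c : (ZMod n)ˣ, ((ψ c)⁻¹ : Fˣ) * φ (pw ζ (c : ZMod n)) := by
  classical
  set G1 := ∑ u : (ZMod n)ˣ, (ψ u : F) * pw ζ (-(u : ZMod n)) with hG1
  calc gammaTransform ζ φ ψ
      = (n : F)⁻¹ * ∑ c : ZMod n, φ (pw ζ c) * ∑ u : (ZMod n)ˣ, (ψ u : F) * pw ζ (-(c * (u : ZMod n))) := by
        rw [gammaTransform_def]
        simp only [levelMeasure_def, mul_sum]
        rw [sum_comm]
        exact sum_congr rfl fun c _ ↦ sum_congr rfl fun u _ ↦ by ring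
    _ = (n : F)⁻¹ * ∑ c : (ZMod n)ˣ, φ (pw ζ (c : ZMod n)) * (((ψ c)⁻¹ : Fˣ) * G1) := by
        congr 1
        rw [sum_eq_sum_units_of_eq_zero]
        · exact sum_congr rfl fun c _ ↦ by rw [sum_psi_pw_neg_mul_unit ψ c]
        · intro c hc
          rw [sum_psi_pw_neg_mul_eq_zero ψ hg hψg hc, mul_zero]
    _ = _ := by
        rw [mul_assoc]
        congr 1
        rw [mul_sum]
        exact sum_congr rfl fun c _ ↦ by ring

end Gamma

/-! ### Sinnott's Lemma 3.6 (finite form) -/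

section Lemma36

variable {M : ℕ} [hM : Fact M.Prime] {p : ℕ} [hp : Fact p.Prime] [CharP F p]

/-- `β(x) := ∑_{v ∈ V} α(v x)`, the sum of the level measure over the torsion `V ⊂ (ℤ/M^m)ˣ`.
[cite: Sinnott1987, (3.4)] -/
def torsSum {m : ℕ} (ζ : F) (φ : F → F) (x : (ZMod (M ^ m))ˣ) : F :=
  ∑ v ∈ univ.filter (fun v : (ZMod (M ^ m))ˣ ↦ IsTors v),
    levelMeasure ζ φ ((v * x : (ZMod (M ^ m))ˣ) : ZMod (M ^ m))

omit hp [CharP F p] in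
/-- Unfolding `torsSum`. [folklore] -/
theorem torsSum_def {m : ℕ} (ζ : F) (φ : F → F) (x : (ZMod (M ^ m))ˣ) :
    torsSum ζ φ x = ∑ v ∈ univ.filter (fun v : (ZMod (M ^ m))ˣ ↦ IsTors v),
      levelMeasure ζ φ ((v * x : (ZMod (M ^ m))ˣ) : ZMod (M ^ m)) := rfl

variable {m : ℕ} {ζ : F} {φ : F → F} {ψ : (ZMod (M ^ m))ˣ →* Fˣ}

omit hp [CharP F p] in
/-- For `ψ` trivial on `V`, every value `ψ(u)` is an `M^m`-th root of unity. [cite: Sinnott1987,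
§1.11] -/
theorem val_psi_pow_eq_one (hm : 1 ≤ m) (hK1 : ∀ v, IsTors v → ψ v = 1) (u : (ZMod (M ^ m))ˣ) :
    ((ψ u : Fˣ) : F) ^ M ^ m = 1 := by
  rw [← Units.val_pow_eq_pow_val, ← map_pow, hK1 _ (isTors_pow_pow hm u), Units.val_one]

omit hM hp [CharP F p] in
/-- For `ψ` with kernel exactly `V`: `ψ(u)^k = 1 ↔ u^k ∈ V`. [cite: Sinnott1987, §1.11] -/
theorem val_psi_pow_eq_one_iff (hK1 : ∀ v, IsTors v → ψ v = 1) (hK2 : ∀ u, ψ u = 1 → IsTors u)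
    (u : (ZMod (M ^ m))ˣ) (k : ℕ) : ((ψ u : Fˣ) : F) ^ k = 1 ↔ IsTors (u ^ k) := by
  rw [← Units.val_pow_eq_pow_val, ← map_pow, Units.val_eq_one]
  exact ⟨hK2 _, hK1 _⟩

omit hM in
/-- The order of an `M^m`-th root of unity is `M^s` for some `s ≤ m`, and it is a primitive
`M^s`-th root of unity. [folklore] -/
theorem exists_isPrimitiveRoot_of_pow_eq_one (hMp : M.Prime) {x : F} (hx : x ^ M ^ m = 1) :
    ∃ s ≤ m, IsPrimitiveRoot x (M ^ s) := by
  have hdvd : orderOf x ∣ M ^ m := orderOf_dvd_of_pow_eq_one hx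
  obtain ⟨s, hs, hs'⟩ := (Nat.dvd_prime_pow hMp).mp hdvd
  exact ⟨s, hs, hs' ▸ IsPrimitiveRoot.orderOf x⟩

/-- **The Frobenius trace of `ψ(u)`**: with `q = p^d`, `M^{n₀} ∥ q - 1`, level `m = n₀ + r`:
`T(ψ u) = M^r ψ(u)` if `u^{M^{n₀}} ∈ V` and `T(ψ u) = 0` otherwise.
[cite: Sinnott1987, (3.5) and proof of Lemma 3.6] -/
theorem frobTrace_val_psi (hMp : M ≠ p) {q : ℕ} (hq : GoodModulus M q) {n₀ r : ℕ}
    (hn₀ : padicValNat M (q - 1) = n₀) (hm : m = n₀ + r) (hK1 : ∀ v, IsTors v → ψ v = 1)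
    (hK2 : ∀ u, ψ u = 1 → IsTors u) (u : (ZMod (M ^ m))ˣ) :
    frobTrace q (M ^ r) ((ψ u : Fˣ) : F) =
      if IsTors (u ^ M ^ n₀) then (M ^ r : ℕ) * ((ψ u : Fˣ) : F) else 0 := by
  have hm1 : 1 ≤ m := by
    have := hq.one_le_padicValNat; omega
  split_ifs with h
  · rw [← val_psi_pow_eq_one_iff hK1 hK2] at h
    exact frobTrace_eq_of_pow_pow_eq_one (F := F) hq (s := n₀) (hn₀ ▸ le_rfl) h (M ^ r)
  · rw [← val_psi_pow_eq_one_iff hK1 hK2] at h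
    obtain ⟨s, hsm, hprim⟩ := exists_isPrimitiveRoot_of_pow_eq_one hM.out
      (val_psi_pow_eq_one hm1 hK1 u)
    have hs : n₀ < s := by
      by_contra hle
      apply h
      rw [hprim.pow_eq_one_iff_dvd]
      exact pow_dvd_pow M (not_lt.mp hle)
    exact frobTrace_eq_zero_of_isPrimitiveRoot hMp hq (by omega) (by omega) hprim

/-- Step (i) of Lemma 3.6: `Γ(ψ) = 0 ⟹ ∑_u ψ(u) α(u y) = 0` for every unit `y`.
[cite: Sinnott1987, (3.7)] -/
theorem sum_psi_mul_levelMeasure_eq_zero (hΓ : gammaTransform ζ φ ψ = 0)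
    (y : (ZMod (M ^ m))ˣ) :
    ∑ u : (ZMod (M ^ m))ˣ, (ψ u : F) * levelMeasure ζ φ ((u * y : (ZMod (M ^ m))ˣ) : ZMod (M ^ m)) = 0 := by
  have : ∑ u : (ZMod (M ^ m))ˣ, (ψ u : F) * levelMeasure ζ φ ((u * y : (ZMod (M ^ m))ˣ) : ZMod (M ^ m))
      = (ψ y⁻¹ : F) * gammaTransform ζ φ ψ := by
    rw [gammaTransform_def, mul_sum, ← Equiv.sum_comp (Equiv.mulRight y⁻¹) _]
    refine sum_congr rfl fun u _ ↦ ?_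
    simp only [Equiv.coe_mulRight, map_mul, map_inv, Units.val_mul, inv_mul_cancel_right]
    ring
  rw [this, hΓ, mul_zero]

/-- Steps (ii)–(iii) of Lemma 3.6: applying the Frobenius trace,
`∑_{u : u^{M^{n₀}} ∈ V} ψ(u) α(u y) = 0`. [cite: Sinnott1987, (3.7)] -/
theorem sum_filter_psi_mul_levelMeasure_eq_zero (hMp : M ≠ p) {q d : ℕ} (hqd : q = p ^ d)
    (hq : GoodModulus M q) {n₀ r : ℕ} (hn₀ : padicValNat M (q - 1) = n₀) (hm : m = n₀ + r)
    (hζ : ζ ^ M ^ m = 1) (hφ : ∀ x : F, x ^ M ^ m = 1 → φ x ^ q = φ (x ^ q))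
    (hK1 : ∀ v, IsTors v → ψ v = 1) (hK2 : ∀ u, ψ u = 1 → IsTors u)
    (hΓ : gammaTransform ζ φ ψ = 0) (y : (ZMod (M ^ m))ˣ) :
    ∑ u ∈ univ.filter (fun u : (ZMod (M ^ m))ˣ ↦ IsTors (u ^ M ^ n₀)),
      (ψ u : F) * levelMeasure ζ φ ((u * y : (ZMod (M ^ m))ˣ) : ZMod (M ^ m)) = 0 := by
  classical
  have hqn : q.Coprime (M ^ m) :=
    Nat.Coprime.pow_right _ ((Nat.coprime_comm).mp ((Nat.Prime.coprime_iff_not_dvd hM.out).mpr hq.not_dvd))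
  have h0 := sum_psi_mul_levelMeasure_eq_zero hΓ y
  have h1 := congrArg (frobTrace q (M ^ r)) h0
  rw [frobTrace_zero (by rw [hqd]; exact pow_ne_zero _ hp.out.ne_zero), frobTrace_sum hqd] at h1
  have h2 : ∀ u : (ZMod (M ^ m))ˣ,
      frobTrace q (M ^ r) ((ψ u : F) * levelMeasure ζ φ ((u * y : (ZMod (M ^ m))ˣ) : ZMod (M ^ m)))
        = (M ^ r : ℕ) * if IsTors (u ^ M ^ n₀) then
            (ψ u : F) * levelMeasure ζ φ ((u * y : (ZMod (M ^ m))ˣ) : ZMod (M ^ m)) else 0 := by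
    intro u
    rw [mul_comm ((ψ u : Fˣ) : F), frobTrace_mul_of_pow_eq _ (levelMeasure_pow_eq hqd hqn hζ hφ _),
      frobTrace_val_psi hMp hq hn₀ hm hK1 hK2]
    split_ifs <;> ring
  simp_rw [h2, ← mul_sum, mul_eq_zero] at h1
  rcases h1 with h1 | h1
  · exfalso
    rw [Nat.cast_pow, pow_eq_zero_iff', CharP.cast_eq_zero_iff F p] at h1
    exact hMp ((Nat.prime_dvd_prime_iff_eq hp.out hM.out).mp h1.1).symm
  · rwa [sum_ite, sum_const_zero, add_zero] at h1

/-- Steps (iii)–(iv) of Lemma 3.6: with `g_k = 1 + k M^r` (`k < M^{n₀}`),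
`∑_k ψ(g_k) β(g_k y) = 0`. [cite: Sinnott1987, (3.7)–(3.9)] -/
theorem sum_range_psi_mul_torsSum_eq_zero (hMp : M ≠ p) {q d : ℕ} (hqd : q = p ^ d)
    (hq : GoodModulus M q) {n₀ r : ℕ} (hn₀ : padicValNat M (q - 1) = n₀) (hm : m = n₀ + r)
    (hr : n₀ ≤ r) (hζ : ζ ^ M ^ m = 1) (hφ : ∀ x : F, x ^ M ^ m = 1 → φ x ^ q = φ (x ^ q))
    (hK1 : ∀ v, IsTors v → ψ v = 1) (hK2 : ∀ u, ψ u = 1 → IsTors u)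
    (hΓ : gammaTransform ζ φ ψ = 0) (y : (ZMod (M ^ m))ˣ) :
    ∑ k ∈ range (M ^ n₀), (ψ (unitOneAdd m r k) : F) * torsSum ζ φ (unitOneAdd m r k * y) = 0 := by
  classical
  have hd : depth M ≤ n₀ := by
    rw [← hn₀]
    have h1 := hq.one_le_padicValNat
    unfold depth; split_ifs with h2
    · subst h2
      have h4 := hq.four_dvd rfl
      have hq1 : q - 1 ≠ 0 := by have := hq.one_lt; omega
      have : 2 ^ 2 ∣ q - 1 := by norm_num; exact h4
      exact (padicValNat_dvd_iff_le hq1).mp this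
    · exact h1
  have h1r : 1 ≤ r := le_trans (le_trans (one_le_depth M) hd) hr
  have h := sum_filter_psi_mul_levelMeasure_eq_zero hMp hqd hq hn₀ hm hζ hφ hK1 hK2 hΓ y
  have hmr : m - r = n₀ := by omega
  rw [← hmr, sum_filter_isTors_pow_eq h1r (le_trans hd hr) (by omega), sum_comm] at h
  rw [hmr] at h
  rw [← h]
  refine sum_congr rfl fun k _ ↦ ?_
  rw [torsSum_def, mul_sum]
  refine sum_congr rfl fun v hv ↦ ?_
  rw [mem_filter] at hv
  rw [map_mul, hK1 v hv.2, one_mul, mul_assoc]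

/-- The character value `ξ₀ = ψ(1 + M^r)` is a primitive `M^{n₀}`-th root of unity
(`m = n₀ + r`, `n₀ ≤ r`, `1 ≤ n₀`). [cite: Sinnott1987, Lemma 3.6 ("`ξ` has order `p^{n+n₀}`")] -/
theorem isPrimitiveRoot_psi_unitOneAdd {n₀ r : ℕ} (hm : m = n₀ + r) (hr : n₀ ≤ r) (hn : 1 ≤ n₀)
    (hd : depth M ≤ r) (hK1 : ∀ v, IsTors v → ψ v = 1) (hK2 : ∀ u, ψ u = 1 → IsTors u) :
    IsPrimitiveRoot ((ψ (unitOneAdd m r 1) : Fˣ) : F) (M ^ n₀) := by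
  have hm1 : 1 ≤ m := by omega
  have h1r : 1 ≤ r := by omega
  obtain ⟨n₁, rfl⟩ : ∃ n₁, n₀ = n₁ + 1 := ⟨n₀ - 1, by omega⟩
  have hcong : CongOne r ((unitOneAdd m r 1 : (ZMod (M ^ m))ˣ) : ZMod (M ^ m)) :=
    congOne_unitOneAdd h1r (by omega) (Nat.one_lt_pow (by omega) hM.out.one_lt)
  have hfin : ((ψ (unitOneAdd m r 1) : Fˣ) : F) ^ M ^ (n₁ + 1) = 1 := by
    rw [val_psi_pow_eq_one_iff hK1 hK2]
    rw [pow_pow_eq_one_of_congOne hd hm1 (by omega) hcong]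
    exact isTors_one
  have hnot : ¬ ((ψ (unitOneAdd m r 1) : Fˣ) : F) ^ M ^ n₁ = 1 := by
    rw [val_psi_pow_eq_one_iff hK1 hK2]
    intro htors
    have hc : CongOne (depth M) ((unitOneAdd m r 1 ^ M ^ n₁ : (ZMod (M ^ m))ˣ) : ZMod (M ^ m)) := by
      rw [Units.val_pow_eq_pow_val]
      exact (hcong.pow (by omega) hm1 _).mono hd
    have h1 := eq_one_of_isTors_of_congOne (by omega) htors hc
    -- but `(1 + M^r)^{M^{n₁}} = 1 + M^{r + n₁} ≠ 1` since `r + n₁ < m`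
    rw [unitOneAdd_one_pow h1r (by omega)] at h1
    have hval := val_unitOneAdd (m := m) h1r (by omega)
      (show M ^ n₁ < M ^ (m - r) from Nat.pow_lt_pow_right hM.out.one_lt (by omega))
    rw [h1, Units.val_one] at hval
    have : Fact (1 < M ^ m) := ⟨Nat.one_lt_pow (by omega) hM.out.one_lt⟩
    rw [ZMod.val_one] at hval
    have := pow_pos hM.out.pos r
    have := pow_pos hM.out.pos n₁
    nlinarith
  have := orderOf_eq_prime_pow hnot hfin
  rw [← this]
  exact IsPrimitiveRoot.orderOf _

/-- Steps (iv)–(v) of Lemma 3.6: there is a unit `e₀` (with `ζ^{e₀ M^r} = ψ(1 + M^r)`) such that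
`∑_{w ≡ 1 (M^r)} ζ^{e₀ w} β(w y) = 0` for all units `y`. [cite: Sinnott1987, (3.8)–(3.9)] -/
theorem exists_sum_filter_congOne_pw_mul_torsSum_eq_zero (hMp : M ≠ p) {q d : ℕ} (hqd : q = p ^ d)
    (hq : GoodModulus M q) {n₀ r : ℕ} (hn₀ : padicValNat M (q - 1) = n₀) (hm : m = n₀ + r)
    (hr : n₀ ≤ r) (hζ : IsPrimitiveRoot ζ (M ^ m))
    (hφ : ∀ x : F, x ^ M ^ m = 1 → φ x ^ q = φ (x ^ q))
    (hK1 : ∀ v, IsTors v → ψ v = 1) (hK2 : ∀ u, ψ u = 1 → IsTors u)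
    (hΓ : gammaTransform ζ φ ψ = 0) :
    ∃ e₀ : (ZMod (M ^ m))ˣ, ∀ y : (ZMod (M ^ m))ˣ,
      ∑ w ∈ univ.filter (fun w : (ZMod (M ^ m))ˣ ↦ CongOne r (w : ZMod (M ^ m))),
        pw ζ ((e₀ * w : (ZMod (M ^ m))ˣ) : ZMod (M ^ m)) * torsSum ζ φ (w * y) = 0 := by
  classical
  have hn1 : 1 ≤ n₀ := hn₀ ▸ hq.one_le_padicValNat
  have hd : depth M ≤ n₀ := by
    rw [← hn₀]
    unfold depth; split_ifs with h2
    · subst h2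
      have hq1 : q - 1 ≠ 0 := by have := hq.one_lt; omega
      have : 2 ^ 2 ∣ q - 1 := by norm_num; exact hq.four_dvd rfl
      exact (padicValNat_dvd_iff_le hq1).mp this
    · exact hq.one_le_padicValNat
  have hm1 : 1 ≤ m := by omega
  have h1r : 1 ≤ r := by omega
  have hMm : 0 < M ^ m := pow_pos hM.out.pos m
  -- the two primitive `M^{n₀}`-th roots of unity `ξ₀ = ψ(1 + M^r)` and `ζ^{M^r}`
  set ξ₀ : F := ((ψ (unitOneAdd m r 1) : Fˣ) : F) with hξ₀
  have hξ₀prim : IsPrimitiveRoot ξ₀ (M ^ n₀) :=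
    isPrimitiveRoot_psi_unitOneAdd hm hr hn1 (le_trans hd hr) hK1 hK2
  have hζr : IsPrimitiveRoot (ζ ^ M ^ r) (M ^ n₀) :=
    hζ.pow hMm (by rw [hm, pow_add, mul_comm])
  obtain ⟨a, -, ha⟩ := hζr.eq_pow_of_pow_eq_one hξ₀prim.pow_eq_one
  have hacop : a.Coprime (M ^ n₀) := (hζr.pow_iff_coprime (pow_pos hM.out.pos _) a).mp (ha ▸ hξ₀prim)
  have hacopM : a.Coprime (M ^ m) := by
    apply Nat.Coprime.pow_right
    exact (Nat.Coprime.coprime_dvd_right (dvd_pow_self M (by omega)) hacop)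
  refine ⟨ZMod.unitOfCoprime a hacopM, fun y ↦ ?_⟩
  have h := sum_range_psi_mul_torsSum_eq_zero hMp hqd hq hn₀ hm hr hζ.pow_eq_one hφ hK1 hK2 hΓ y
  -- `ψ(g_k) = ξ₀^k` and `ζ^{e₀ g_k} = ζ^{a} ξ₀^k`
  have hpw : ∀ k, pw ζ ((ZMod.unitOfCoprime a hacopM * unitOneAdd m r k : (ZMod (M ^ m))ˣ) :
      ZMod (M ^ m)) = ζ ^ a * ξ₀ ^ k := by
    intro k
    rw [Units.val_mul, ZMod.coe_unitOfCoprime, coe_unitOneAdd h1r, ← Nat.cast_mul,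
      pw_natCast hζ.pow_eq_one, mul_add, mul_one, pow_add, ← ha, ← pow_mul, ← pow_mul]
    congr 1; ring
  have hψ : ∀ k, ((ψ (unitOneAdd m r k) : Fˣ) : F) = ξ₀ ^ k := by
    intro k
    rw [← unitOneAdd_one_pow h1r (by omega), map_pow, Units.val_pow_eq_pow_val]
  have hmr : m - r = n₀ := by omega
  rw [sum_filter_congOne_eq h1r (by omega)]
  simp_rw [hpw, mul_assoc, ← mul_sum]
  simp_rw [hψ] at h
  rw [hmr, h, mul_zero]

/-- `β` takes values in `𝔽_q`. [cite: Sinnott1987, §1.16 and (3.5)] -/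
theorem torsSum_pow_eq {q d : ℕ} (hqd : q = p ^ d) (hqn : q.Coprime (M ^ m)) (hζ : ζ ^ M ^ m = 1)
    (hφ : ∀ x : F, x ^ M ^ m = 1 → φ x ^ q = φ (x ^ q)) (x : (ZMod (M ^ m))ˣ) :
    torsSum ζ φ x ^ q = torsSum ζ φ x := by
  rw [torsSum_def, hqd, sum_pow_char_pow, ← hqd]
  exact sum_congr rfl fun v _ ↦ levelMeasure_pow_eq hqd hqn hζ hφ _

/-- The unit `q̂ = q mod M^m`. [folklore] -/
def qUnit (m : ℕ) {q : ℕ} (hq : GoodModulus M q) : (ZMod (M ^ m))ˣ :=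
  ZMod.unitOfCoprime q (Nat.Coprime.pow_right _
    ((Nat.coprime_comm).mp ((Nat.Prime.coprime_iff_not_dvd hM.out).mpr hq.not_dvd)))

omit hp [CharP F p] in
/-- The value of `qUnit`. [folklore] -/
theorem coe_qUnit {q : ℕ} (hq : GoodModulus M q) : ((qUnit m hq : (ZMod (M ^ m))ˣ) : ZMod (M ^ m)) = q :=
  ZMod.coe_unitOfCoprime _ _

omit hp [CharP F p] in
/-- `q̂ ≡ 1 (mod M^{n₀})` for `n₀ = v_M(q - 1)`. [cite: Sinnott1987, §3 (`k = k(μ_{p^{n₀}})`)] -/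
theorem congOne_qUnit {q : ℕ} (hq : GoodModulus M q) {n₀ : ℕ} (hn₀ : padicValNat M (q - 1) = n₀)
    (hn : n₀ ≤ m) : CongOne n₀ ((qUnit m hq : (ZMod (M ^ m))ˣ) : ZMod (M ^ m)) := by
  rw [congOne_iff, coe_qUnit, ZMod.val_natCast]
  have h1 : M ^ n₀ ∣ q - 1 := hn₀ ▸ pow_padicValNat_dvd
  have h2 : q % M ^ m ≡ q [MOD M ^ n₀] := (Nat.mod_modEq q (M ^ m)).of_dvd (pow_dvd_pow M hn)
  exact h2.trans ((Nat.modEq_iff_dvd' hq.one_lt.le).mpr h1).symm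

omit hp [CharP F p] in
/-- No power `q̂^i`, `0 < i < M^{r-n₀}`, is `≡ 1 (mod M^r)` (lifting the exponent).
[cite: Sinnott1987, §3 (`Gal(K/k) ≅ 1 + p^{n₀}ℤ_p`)] -/
theorem not_congOne_qUnit_pow {q : ℕ} (hq : GoodModulus M q) {n₀ r : ℕ}
    (hn₀ : padicValNat M (q - 1) = n₀) (hrm : r ≤ m) {i : ℕ} (hi : 0 < i) (hi' : i < M ^ (r - n₀)) :
    ¬ CongOne r ((qUnit m hq ^ i : (ZMod (M ^ m))ˣ) : ZMod (M ^ m)) := by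
  intro h
  rw [congOne_iff, Units.val_pow_eq_pow_val, coe_qUnit, ← Nat.cast_pow, ZMod.val_natCast] at h
  have h1 : q ^ i ≡ 1 [MOD M ^ r] :=
    (((Nat.mod_modEq (q ^ i) (M ^ m)).of_dvd (pow_dvd_pow M hrm)).symm).trans h
  have hqi : 1 ≤ q ^ i := Nat.one_le_pow _ _ (by have := hq.one_lt; omega)
  have h2 : M ^ r ∣ q ^ i - 1 := (Nat.modEq_iff_dvd' hqi).mp h1.symm
  have hne : q ^ i - 1 ≠ 0 := by
    have := Nat.one_lt_pow hi.ne' hq.one_lt; omega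
  rw [padicValNat_dvd_iff_le hne, padicValNat_pow_sub_one hq hi.ne', hn₀] at h2
  have h3 : M ^ (r - n₀) ∣ i := by
    rw [padicValNat_dvd_iff_le hi.ne']; omega
  exact absurd (Nat.le_of_dvd hi h3) (not_le.mpr hi')

/-- **Sinnott's Lemma 3.6 (finite form).**  Let `q = p^d` with `M ∣ q - 1` (`4 ∣ q - 1` if
`M = 2`), `M^{n₀} ∥ q - 1`, `m = n₀ + r` with `r ≥ n₀`, `ζ` a primitive `M^m`-th root of unity,
`φ` Frobenius-equivariant on `μ_{M^m}` (`φ(x)^q = φ(x^q)`), and `ψ` a character of `(ℤ/M^m)ˣ`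
with kernel exactly `V`.  If `Γ_α(ψ) = 0` then there is a unit `e₀` such that for every unit `y`
`∑_{t ≡ 1 (M^{n₀})} ζ^{e₀ t} β(t y) = 0`, where `β(x) = ∑_{v ∈ V} α(v x)`.
[cite: Sinnott1987, Lemma 3.6] -/
theorem lemma36 (hMp : M ≠ p) {q d : ℕ} (hqd : q = p ^ d) (hq : GoodModulus M q) {n₀ r : ℕ}
    (hn₀ : padicValNat M (q - 1) = n₀) (hm : m = n₀ + r) (hr : n₀ ≤ r)
    (hζ : IsPrimitiveRoot ζ (M ^ m)) (hφ : ∀ x : F, x ^ M ^ m = 1 → φ x ^ q = φ (x ^ q))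
    (hK1 : ∀ v, IsTors v → ψ v = 1) (hK2 : ∀ u, ψ u = 1 → IsTors u)
    (hΓ : gammaTransform ζ φ ψ = 0) :
    ∃ e₀ : (ZMod (M ^ m))ˣ, ∀ y : (ZMod (M ^ m))ˣ,
      ∑ t ∈ univ.filter (fun t : (ZMod (M ^ m))ˣ ↦ CongOne n₀ (t : ZMod (M ^ m))),
        pw ζ ((e₀ * t : (ZMod (M ^ m))ˣ) : ZMod (M ^ m)) * torsSum ζ φ (t * y) = 0 := by
  classical
  have hn1 : 1 ≤ n₀ := hn₀ ▸ hq.one_le_padicValNat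
  have hqn : q.Coprime (M ^ m) :=
    Nat.Coprime.pow_right _ ((Nat.coprime_comm).mp ((Nat.Prime.coprime_iff_not_dvd hM.out).mpr hq.not_dvd))
  obtain ⟨e₀, he₀⟩ := exists_sum_filter_congOne_pw_mul_torsSum_eq_zero hMp hqd hq hn₀ hm hr hζ hφ
    hK1 hK2 hΓ
  refine ⟨e₀, fun y ↦ ?_⟩
  set g := (qUnit m hq : (ZMod (M ^ m))ˣ) with hg
  -- spread (5*) over the cosets `g^i K_r` of `K_{n₀}` using Frobenius
  have hstep : ∀ i : ℕ, ∑ w ∈ univ.filter (fun w : (ZMod (M ^ m))ˣ ↦ CongOne r (w : ZMod (M ^ m))),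
      pw ζ ((e₀ * (g ^ i * w) : (ZMod (M ^ m))ˣ) : ZMod (M ^ m)) * torsSum ζ φ (g ^ i * w * y) = 0 := by
    intro i
    have hq0 : q ≠ 0 := by rw [hqd]; exact pow_ne_zero _ hp.out.ne_zero
    have h := he₀ (g ^ i * y)
    have h' : (∑ w ∈ univ.filter (fun w : (ZMod (M ^ m))ˣ ↦ CongOne r (w : ZMod (M ^ m))),
        pw ζ ((e₀ * w : (ZMod (M ^ m))ˣ) : ZMod (M ^ m)) * torsSum ζ φ (w * (g ^ i * y))) ^ q ^ i = 0 := by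
      rw [h, zero_pow (pow_ne_zero _ hq0)]
    rw [hqd, ← pow_mul, sum_pow_char_pow] at h'
    rw [← h']
    refine sum_congr rfl fun w _ ↦ ?_
    rw [mul_pow, pow_mul, ← hqd, pow_pow_eq_self_of_pow_eq (torsSum_pow_eq hqd hqn hζ.pow_eq_one hφ _),
      ← mul_assoc, ← mul_assoc, mul_comm w (g ^ i), ← pw_mul_natCast hζ.pow_eq_one]
    congr 2
    push_cast
    rw [hg, coe_qUnit]; ring
  rw [sum_filter_congOne_eq_sum_sum hn1 hr (by omega) (congOne_qUnit hq hn₀ (by omega))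
    (fun i hi hi' ↦ not_congOne_qUnit_pow hq hn₀ (by omega) hi hi')]
  exact sum_eq_zero fun i _ ↦ hstep i

end Lemma36

/-! ### Part 2: the Fourier transform of `β` on a class modulo `M^{n₀}` (Sinnott's `R_{η,y}`) -/

section ClassInversion

variable {M : ℕ} [hM : Fact M.Prime]

/-- Sinnott's averaged function `R_{a}(W) = M^{-n₀} ∑_{ε ∈ μ_{M^{n₀}}} ε^{-a} φ(ε W)`, written with
a primitive `N`-th root of unity `ε` (`N = M^{n₀}`): `Rfun ε φ a W = N⁻¹ ∑_{j mod N} ε^{-ja} φ(ε^j W)`.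
[cite: Sinnott1987, proof of Theorem 3.2 (definition of `R_{η,y}`)] -/
def Rfun {N : ℕ} [NeZero N] (ε : F) (φ : F → F) (a : ZMod N) (W : F) : F :=
  (N : F)⁻¹ * ∑ j : ZMod N, pw ε (-(j * a)) * φ (pw ε j * W)

/-- Unfolding `Rfun`. [folklore] -/
theorem Rfun_def {N : ℕ} [NeZero N] (ε : F) (φ : F → F) (a : ZMod N) (W : F) :
    Rfun ε φ a W = (N : F)⁻¹ * ∑ j : ZMod N, pw ε (-(j * a)) * φ (pw ε j * W) := rfl

/-- **`Rfun` does not depend on the choice of the primitive `N`-th root of unity.** [folklore] -/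
theorem Rfun_eq_of_isPrimitiveRoot {N : ℕ} [NeZero N] {ε ε' : F} (hε : IsPrimitiveRoot ε N)
    (hε' : IsPrimitiveRoot ε' N) (φ : F → F) (a : ZMod N) (W : F) :
    Rfun ε' φ a W = Rfun ε φ a W := by
  classical
  obtain ⟨b, -, hb⟩ := hε.eq_pow_of_pow_eq_one hε'.pow_eq_one
  have hbcop : b.Coprime N := (hε.pow_iff_coprime (Nat.pos_of_ne_zero (NeZero.ne N)) b).mp (hb ▸ hε')
  set bu : (ZMod N)ˣ := ZMod.unitOfCoprime b hbcop with hbu_def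
  have hbu : (bu : ZMod N) = (b : ZMod N) := ZMod.coe_unitOfCoprime _ _
  rw [Rfun_def, Rfun_def]
  congr 1
  conv_rhs => rw [← Equiv.sum_comp (Units.mulLeft bu)]
  refine sum_congr rfl fun j _ ↦ ?_
  simp only [Units.mulLeft_apply, hbu, ← hb, pw_pow hε.pow_eq_one]
  congr 2
  ring

variable {m n₀ r : ℕ} {ζ : F}

/-- The reduction `ℤ/M^{n₀+r} → ℤ/M^{n₀}`. [folklore] -/
abbrev castDown (n₀ r : ℕ) : ZMod (M ^ (n₀ + r)) →+* ZMod (M ^ n₀) :=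
  ZMod.castHom (pow_dvd_pow M (Nat.le_add_right n₀ r)) (ZMod (M ^ n₀))

/-- `ζ^{M^r z} = (ζ^{M^r})^{z mod M^{n₀}}` for a `M^{n₀+r}`-th root of unity `ζ`. [folklore] -/
theorem pw_pow_mul (hζ : ζ ^ M ^ (n₀ + r) = 1) (z : ZMod (M ^ (n₀ + r))) :
    pw ζ (((M ^ r : ℕ) : ZMod (M ^ (n₀ + r))) * z) = pw (ζ ^ M ^ r) (castDown n₀ r z) := by
  rw [pw_def, pw_def, ← pow_mul]
  refine pow_eq_pow_of_modEq hζ ?_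
  rw [ZMod.val_mul, ZMod.val_natCast, ZMod.castHom_apply, ZMod.cast_eq_val, ZMod.val_natCast]
  have h1 : M ^ r % M ^ (n₀ + r) * z.val % M ^ (n₀ + r) ≡ M ^ r * z.val [MOD M ^ (n₀ + r)] :=
    (Nat.mod_modEq _ _).trans ((Nat.mod_modEq _ _).mul_right _)
  refine h1.trans ?_
  -- `M^r z ≡ M^r (z mod M^{n₀})` modulo `M^{n₀ + r}`
  rw [Nat.modEq_iff_dvd]
  have := Nat.div_add_mod z.val (M ^ n₀)
  refine ⟨-(z.val / M ^ n₀ : ℕ), ?_⟩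
  push_cast
  have h := congrArg (fun t : ℕ ↦ (t : ℤ)) this
  push_cast at h
  linear_combination (M : ℤ) ^ r * h

/-- For a primitive `n`-th root of unity, `ζ^x = 1 ↔ x = 0` in `ℤ/n`. [folklore] -/
theorem pw_eq_one_iff {n : ℕ} [NeZero n] {ζ : F} (hζ : IsPrimitiveRoot ζ n) (x : ZMod n) :
    pw ζ x = 1 ↔ x = 0 := by
  rw [pw_def, hζ.pow_eq_one_iff_dvd, ← ZMod.natCast_eq_zero_iff, ZMod.natCast_zmod_val]

/-- A geometric sum of a nontrivial root of unity vanishes. [folklore] -/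
theorem sum_range_pow_eq_zero {ω : F} {L : ℕ} (hω : ω ^ L = 1) (h : ω ≠ 1) :
    ∑ k ∈ range L, ω ^ k = 0 := by
  have := geom_sum_mul ω L
  rw [hω, sub_self, mul_eq_zero, sub_eq_zero] at this
  exact this.resolve_right h

/-- The characters `t ↦ ζ^{s t}` summed over `t ≡ 1 (mod M^{n₀})` in `ℤ/M^{n₀+r}`:
`∑_t ζ^{s t} = ζ^s M^r [M^{n₀} s = 0]`. [cite: Sinnott1987, proof of Theorem 3.2] -/
theorem sum_filter_congOne_pw_mul (hζ : IsPrimitiveRoot ζ (M ^ (n₀ + r))) (hn : 1 ≤ n₀)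
    (s : ZMod (M ^ (n₀ + r))) :
    ∑ t ∈ univ.filter (fun t : (ZMod (M ^ (n₀ + r)))ˣ ↦ CongOne n₀ (t : ZMod (M ^ (n₀ + r)))),
      pw ζ (s * (t : ZMod (M ^ (n₀ + r)))) =
        if ((M ^ n₀ : ℕ) : ZMod (M ^ (n₀ + r))) * s = 0 then pw ζ s * (M ^ r : ℕ) else 0 := by
  classical
  have hζ1 := hζ.pow_eq_one
  rw [sum_filter_congOne_eq hn (Nat.le_add_right n₀ r)]
  have hexp : ∀ k : ℕ,
      pw ζ (s * ((unitOneAdd (n₀ + r) n₀ k : (ZMod (M ^ (n₀ + r)))ˣ) : ZMod (M ^ (n₀ + r)))) =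
      pw ζ s * (pw ζ (((M ^ n₀ : ℕ) : ZMod (M ^ (n₀ + r))) * s)) ^ k := by
    intro k
    rw [coe_unitOneAdd hn, ← pw_mul_natCast hζ1, ← pw_add hζ1]
    congr 1; push_cast; ring
  simp_rw [hexp, ← mul_sum, Nat.add_sub_cancel_left]
  have hω : (pw ζ (((M ^ n₀ : ℕ) : ZMod (M ^ (n₀ + r))) * s)) ^ M ^ r = 1 := by
    rw [← pw_mul_natCast hζ1]
    have h0 : ((M ^ n₀ : ℕ) : ZMod (M ^ (n₀ + r))) * ((M ^ r : ℕ) : ZMod (M ^ (n₀ + r))) = 0 := by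
      rw [← Nat.cast_mul, ← pow_add, ZMod.natCast_self]
    have : ((M ^ n₀ : ℕ) : ZMod (M ^ (n₀ + r))) * s * ((M ^ r : ℕ) : ZMod (M ^ (n₀ + r))) = 0 := by
      calc _ = ((M ^ n₀ : ℕ) : ZMod (M ^ (n₀ + r))) * ((M ^ r : ℕ) : ZMod (M ^ (n₀ + r))) * s := by
            ring
        _ = 0 := by rw [h0, zero_mul]
    rw [this, pw_zero]
  by_cases hc : ((M ^ n₀ : ℕ) : ZMod (M ^ (n₀ + r))) * s = 0
  · rw [if_pos hc, hc, pw_zero]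
    simp
  · rw [if_neg hc, sum_range_pow_eq_zero hω (fun h ↦ hc ((pw_eq_one_iff hζ _).mp h)), mul_zero]

/-- The solutions `c` of `M^{n₀} (b - c) = 0` in `ℤ/M^{n₀+r}` are exactly `c = b + M^r j`,
`j mod M^{n₀}`. [folklore] -/
theorem filter_mul_sub_eq_zero_eq_image (b : ZMod (M ^ (n₀ + r))) :
    univ.filter (fun c : ZMod (M ^ (n₀ + r)) ↦ ((M ^ n₀ : ℕ) : ZMod (M ^ (n₀ + r))) * (b - c) = 0) =
      univ.image (fun j : ZMod (M ^ n₀) ↦ b + ((M ^ r : ℕ) : ZMod (M ^ (n₀ + r))) * (j.val : ZMod (M ^ (n₀ + r)))) := by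
  classical
  ext c
  simp only [mem_filter, mem_univ, true_and, mem_image]
  constructor
  · intro h
    -- `M^{n₀+r} ∣ M^{n₀} (c - b).val`, so `M^r ∣ (c - b).val`
    have h' : ((M ^ n₀ : ℕ) : ZMod (M ^ (n₀ + r))) * (c - b) = 0 := by
      rw [← neg_sub, mul_neg, h, neg_zero]
    rw [← ZMod.natCast_zmod_val (c - b), ← Nat.cast_mul, ZMod.natCast_eq_zero_iff] at h'
    have h'' : M ^ n₀ * M ^ r ∣ M ^ n₀ * (c - b).val := by rwa [← pow_add]
    have hdvd : M ^ r ∣ (c - b).val := Nat.dvd_of_mul_dvd_mul_left (pow_pos hM.out.pos _) h''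
    obtain ⟨j, hj⟩ := hdvd
    have hjlt : j < M ^ n₀ := by
      have : M ^ r * j < M ^ r * M ^ n₀ :=
        calc M ^ r * j = (c - b).val := hj.symm
          _ < M ^ (n₀ + r) := ZMod.val_lt _
          _ = M ^ r * M ^ n₀ := by rw [pow_add, mul_comm]
      exact Nat.lt_of_mul_lt_mul_left this
    refine ⟨(j : ZMod (M ^ n₀)), ?_⟩
    rw [ZMod.val_natCast, Nat.mod_eq_of_lt hjlt]
    have : (((c - b).val : ℕ) : ZMod (M ^ (n₀ + r))) = c - b := ZMod.natCast_zmod_val _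
    rw [hj, Nat.cast_mul] at this
    rw [this]; ring
  · rintro ⟨j, rfl⟩
    rw [sub_add_cancel_left, mul_neg, ← mul_assoc, ← Nat.cast_mul, ← pow_add, ZMod.natCast_self,
      zero_mul, neg_zero]

omit hM in
/-- The parametrisation `j ↦ b + M^r j` is injective on `ℤ/M^{n₀}`. [folklore] -/
theorem add_pow_mul_val_injective (hMp : 0 < M) (b : ZMod (M ^ (n₀ + r))) :
    Function.Injective
      (fun j : ZMod (M ^ n₀) ↦ b + ((M ^ r : ℕ) : ZMod (M ^ (n₀ + r))) * (j.val : ZMod (M ^ (n₀ + r)))) := by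
  have : NeZero (M ^ (n₀ + r)) := ⟨pow_ne_zero _ hMp.ne'⟩
  have : NeZero (M ^ n₀) := ⟨pow_ne_zero _ hMp.ne'⟩
  intro j j' h
  simp only [add_right_inj] at h
  rw [← Nat.cast_mul, ← Nat.cast_mul, ZMod.natCast_eq_natCast_iff'] at h
  have hlt : ∀ i : ZMod (M ^ n₀), M ^ r * i.val < M ^ (n₀ + r) := fun i ↦ by
    rw [pow_add, mul_comm (M ^ n₀)]
    exact Nat.mul_lt_mul_of_pos_left (ZMod.val_lt i) (pow_pos hMp _)
  rw [Nat.mod_eq_of_lt (hlt j), Nat.mod_eq_of_lt (hlt j')] at h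
  exact ZMod.val_injective _ (Nat.eq_of_mul_eq_mul_left (pow_pos hMp _) h)

/-- **The Fourier transform of the level measure on a class modulo `M^{n₀}`** (`ζ` primitive of
order `M^{n₀+r}`, `a` a unit, `b ∈ ℤ/M^{n₀+r}`):
`∑_{t ≡ 1 (M^{n₀})} ζ^{b a t} α(a t) = Rfun (ζ^{M^r}) φ (a mod M^{n₀}) (ζ^b)`.
[cite: Sinnott1987, proof of Theorem 3.2, (3.11) and (1.10)] -/
theorem sum_filter_congOne_pw_mul_levelMeasure (hMF : (M : F) ≠ 0)
    (hζ : IsPrimitiveRoot ζ (M ^ (n₀ + r))) (hn : 1 ≤ n₀) (φ : F → F)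
    (a : (ZMod (M ^ (n₀ + r)))ˣ) (b : ZMod (M ^ (n₀ + r))) :
    ∑ t ∈ univ.filter (fun t : (ZMod (M ^ (n₀ + r)))ˣ ↦ CongOne n₀ (t : ZMod (M ^ (n₀ + r)))),
      pw ζ (b * ((a * t : (ZMod (M ^ (n₀ + r)))ˣ) : ZMod (M ^ (n₀ + r)))) *
        levelMeasure ζ φ ((a * t : (ZMod (M ^ (n₀ + r)))ˣ) : ZMod (M ^ (n₀ + r))) =
      Rfun (ζ ^ M ^ r) φ (castDown n₀ r (a : ZMod (M ^ (n₀ + r)))) (pw ζ b) := by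
  classical
  have hζ1 := hζ.pow_eq_one
  have hMn : ∀ k : ℕ, ((M ^ k : ℕ) : F) ≠ 0 := fun k ↦ by
    rw [Nat.cast_pow]; exact pow_ne_zero _ hMF
  set K := univ.filter (fun t : (ZMod (M ^ (n₀ + r)))ˣ ↦ CongOne n₀ (t : ZMod (M ^ (n₀ + r)))) with hK
  -- Step 1: expand `α` and interchange
  have h1 : ∑ t ∈ K, pw ζ (b * ((a * t : (ZMod (M ^ (n₀ + r)))ˣ) : ZMod (M ^ (n₀ + r)))) *
        levelMeasure ζ φ ((a * t : (ZMod (M ^ (n₀ + r)))ˣ) : ZMod (M ^ (n₀ + r))) =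
      ((M ^ (n₀ + r) : ℕ) : F)⁻¹ * ∑ c : ZMod (M ^ (n₀ + r)), φ (pw ζ c) *
        ∑ t ∈ K, pw ζ ((b - c) * (a : ZMod (M ^ (n₀ + r))) * (t : ZMod (M ^ (n₀ + r)))) := by
    simp only [levelMeasure_def, mul_sum, Nat.cast_pow]
    rw [sum_comm]
    refine sum_congr rfl fun c _ ↦ sum_congr rfl fun t _ ↦ ?_
    have : pw ζ (b * ((a * t : (ZMod (M ^ (n₀ + r)))ˣ) : ZMod (M ^ (n₀ + r)))) *
        pw ζ (-(c * ((a * t : (ZMod (M ^ (n₀ + r)))ˣ) : ZMod (M ^ (n₀ + r))))) =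
        pw ζ ((b - c) * (a : ZMod (M ^ (n₀ + r))) * (t : ZMod (M ^ (n₀ + r)))) := by
      rw [← pw_add hζ1]; congr 1; push_cast; ring
    rw [← this]; ring
  -- Step 2: the inner sum
  have h2 : ∀ c : ZMod (M ^ (n₀ + r)), ∑ t ∈ K, pw ζ ((b - c) * (a : ZMod (M ^ (n₀ + r))) * (t : ZMod (M ^ (n₀ + r)))) =
      if ((M ^ n₀ : ℕ) : ZMod (M ^ (n₀ + r))) * (b - c) = 0 then
        pw ζ ((b - c) * (a : ZMod (M ^ (n₀ + r)))) * (M ^ r : ℕ) else 0 := by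
    intro c
    rw [hK, sum_filter_congOne_pw_mul hζ hn ((b - c) * (a : ZMod (M ^ (n₀ + r))))]
    have : ((M ^ n₀ : ℕ) : ZMod (M ^ (n₀ + r))) * ((b - c) * (a : ZMod (M ^ (n₀ + r)))) = 0 ↔
        ((M ^ n₀ : ℕ) : ZMod (M ^ (n₀ + r))) * (b - c) = 0 := by
      rw [← mul_assoc]
      exact Units.mul_left_eq_zero a
    simp only [this]
  simp_rw [h1, h2, mul_ite, mul_zero]
  have hfilt : ∀ (P : ZMod (M ^ (n₀ + r)) → Prop) (_ : DecidablePred P) (G : ZMod (M ^ (n₀ + r)) → F),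
      (∑ c : ZMod (M ^ (n₀ + r)), if P c then G c else 0) = ∑ c ∈ univ.filter P, G c :=
    fun P _ G ↦ (Finset.sum_filter P G).symm
  rw [hfilt, filter_mul_sub_eq_zero_eq_image b,
    sum_image (fun j _ j' _ h ↦ add_pow_mul_val_injective hM.out.pos b h)]
  -- Step 3: identify with `Rfun`
  rw [Rfun_def]
  have hconst : ((M ^ (n₀ + r) : ℕ) : F)⁻¹ * ((M ^ r : ℕ) : F) = ((M ^ n₀ : ℕ) : F)⁻¹ := by
    rw [pow_add, Nat.cast_mul, mul_inv, mul_assoc, inv_mul_cancel₀ (hMn r), mul_one]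
  rw [← hconst, mul_assoc]
  congr 1
  rw [mul_sum]
  refine sum_congr rfl fun j _ ↦ ?_
  have hsub : (b - (b + ((M ^ r : ℕ) : ZMod (M ^ (n₀ + r))) * (j.val : ZMod (M ^ (n₀ + r))))) *
      (a : ZMod (M ^ (n₀ + r))) =
      ((M ^ r : ℕ) : ZMod (M ^ (n₀ + r))) * (-((j.val : ZMod (M ^ (n₀ + r))) * a)) := by ring
  have hcastj : castDown n₀ r (j.val : ZMod (M ^ (n₀ + r))) = j := by
    rw [map_natCast, ZMod.natCast_zmod_val]
  rw [hsub, pw_pow_mul hζ1, map_neg, map_mul, hcastj, pw_add hζ1, pw_pow_mul hζ1, hcastj,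
    mul_comm (pw ζ b)]
  push_cast
  ring

end ClassInversion

end Literature.NumberTheory.LFunctions.Sinnott1987
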